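import Mathlib.GroupTheory.Commutator.Basic
import Mathlib.Tactic.Group
import Literature.NumberTheory.FaltingsSerre.ResidualImage
import HarnessLib

/-!
# The Faltings–Serre method after Brumer–Pacetti–Poor–Tornaría–Voight–Yuen, XV:
# residual rigidity — two mod `2` representations with the same kernel field and compatible
# images `S₅(b)` / `S₆` are equivalent (Step 1, `Certificate.residual_eq`, from Route-T field data)

[BPPTVY] = A. Brumer, A. Pacetti, C. Poor, G. Tornaría, J. Voight, D. S. Yuen, *On the paramodularity of
typical abelian surfaces*, Algebra & Number Theory **13**:5 (2019) 1145–1195 [cite: BrumerEtAl2019]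
(PRINTED numbering).

WHAT IS PRINTED.  Step 1 of [BPPTVY, Algorithm 2.2.3 p. 1151] requires the residual representations
`ρ̄₁ = ρ̄_{A,2}, ρ̄₂ = ρ̄_{f,2} : Gal_{ℚ,S} → GSp₄(𝔽₂) = Sp₄(𝔽₂)` to be EQUIVALENT; in the examples
this is read off from FIELD data plus one Frobenius datum:
* `N = 277` [BPPTVY, Lemma 7.1.4 p. 1187]: "The residual representations `ρ̄_A, ρ̄_f` are equivalent
  and have absolutely irreducible image `S₅(b)`" — the proof identifies the fixed field of `ker ρ̄_f`
  with that of `ker ρ̄_A` (Hunter search / [Jones–Roberts 2014]) and then: "we need to distinguish the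
  representations afforded by the inclusion `S₅ ⊆ S₆` and the fixed representation (5.1.1). We refer to
  (5.1.8): for the second one `Frob₃` does not have order `5`, so we must have a match";
* `N = 587` (image `S₆`) [BPPTVY, Theorem 7.3.1, proof pp. 1191–1192]: "the residual representation of
  `f₅₈₇⁻` corresponds then to the same extension as `A`, and since both representations have the same
  trace at `Frob₃`, we deduce that they are indeed equivalent and absolutely irreducible";
* the group theory behind both, [BPPTVY, §5.1 p. 1173]: "There is a unique outer automorphism of `S₆`
  up to inner automorphisms; it sends transpositions to products of three transpositions, and
  interchanges the trace of some order `3` and order `6` elements", and [Example 5.1.9 p. 1174]: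
  "`S₅(a), S₅(b) ≤ S₆` are exchanged by the outer automorphism of `S₆` … `ι(S₅(b))` has transvections
  while `ι(S₅(a))` does not".

WHAT THIS FILE PROVES (kernel, standard axioms): the rigidity statements that turn "same kernel (= same
`2`-torsion field) + compatible images" into "equivalent", for `σ₁ σ₂ : Γ →* Sp₄(𝔽₂) = ι(S₆)`
(`GSp4F2.iotaGL`, `GSp4F2.mem_range_iotaGL`) with `ker σ₁ = ker σ₂`:
* `GSp4F2.exists_conj_of_ker_iff_of_range_eq_stabilizer` (permutation level) /
  `GSp4F2.exists_conj_of_ker_iff_of_range_S5b` (matrix level) — both images point stabilisers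
  (`= S₅(b)` up to conjugacy, the `277/349/461` situation) ⇒ `σ₂ = g σ₁ g⁻¹` for some `g ∈ Sp₄(𝔽₂)`
  (every automorphism of `S₅` is inner; no Frobenius datum needed once both images are KNOWN to be of
  class `S₅(b)`, which Route T gets from a transvection, `GSp4F2.range_eq_S6_or_S5b`);
* `GSp4F2.exists_conj_of_ker_iff_of_transvection` — the ROUTE-T FORM: both images symplectic, same
  kernel, some `σ₁(c)` of order `5`, and ONE `i ∈ Γ` (an inertia generator at `p ∥ N`,
  [BPPTVY, proof of Prop. 5.2.4 p. 1175]) with `σ₁(i)` and `σ₂(i)` both transvections ⇒ conjugate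
  (this covers image `S₆` as well: an automorphism of `S₆` preserving one transposition is inner);
* `GSp4F2.exists_conj_of_ker_iff_of_trace_orderThree` — the PRINTED `587` FORM: `σ₁` onto `Sp₄(𝔽₂)`,
  same kernel, and equal traces at one `u` with `σ₁(u)` of order `3` ⇒ conjugate ((5.1.8): the trace
  separates the two classes `3¹`, `3²` of elements of order `3`, which the outer automorphism swaps).
The engine is three `decide +kernel` rigidity facts about generating pairs of `Stab(6)` and `S₆`
(`exists_conj_pair_S5b`, `exists_conj_pair_S6`) and about involutions versus elements of order `3`
(`isSwap_of_commute_c123`, `isSwap_of_rel_c123c456`, after normalising the order-`3` element to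
`(1 2 3)` resp. `(1 2 3)(4 5 6)`), transported along `ker σ₁ = ker σ₂` by `conj_of_conj_on_generators`.

HOW THE PIPELINE USES IT (cell `pub-paramod`, `DIVERGENCE.md` D-20): with `Γ = Gal(ℚ̄/ℚ)`,
`σ₁ = residual ρ_{A,2}`, `σ₂ = residual ρ_{f,2}`, the certificate's Route-T block supplies exactly the
hypotheses (same splitting field `ℚ(A[2])`; `Φ₅` as a characteristic polynomial mod `2`,
`GSp4F2.pow_five_eq_one_of_charpoly`; transvections from inertia at `N`), and the conclusion
`σ₂ = g σ₁ g⁻¹, g ∈ Sp₄(𝔽₂)` is the equivalence of Step 1; replacing `ρ₂` by a `GSp₄(ℤ₂)`-conjugate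
lifting `g` ([BPPTVY] p. 1157: "we can assume `ρ₁ ≡ ρ₂ (mod ℓ)`"; Lemma 4.3.8(b) p. 1171) turns it into
the literal equality `Certificate.residual_eq` of `ParamodularCertificate.lean`.

## References
* [BPPTVY] ANT 13:5 (2019): Algorithm 2.2.3 p. 1151; §5.1 (5.1.1)–(5.1.8), Lemma 5.1.5 p. 1173;
  Lemma 5.1.7 / Example 5.1.9 p. 1174; Prop. 5.2.4 p. 1175; Lemma 7.1.4 p. 1187; Theorem 7.3.1
  pp. 1191–1192. [cite: BrumerEtAl2019]
-/

namespace Literature.NumberTheory.FaltingsSerre.GSp4F2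

open Equiv Equiv.Perm
open scoped commutatorElement

/-! ### A. Kernel facts: generating pairs of `Stab(6) ≅ S₅` and of `S₆`, involutions vs. order `3` -/

/-- The `6`-cycle `(1 2 3 4 5 6)`. [cite: BrumerEtAl2019, (5.1.2) p. 1173] -/
def c123456 : Perm (Fin 6) := c[(0 : Fin 6), 1, 2, 3, 4, 5]

/-- `(1 2 3 4 5 6) = finRotate 6`. [folklore] -/
theorem c123456_eq_finRotate : c123456 = finRotate 6 := by
  unfold c123456; decide +kernel

/-- `t12 = (1 2)` is the transposition `swap 0 1`. [folklore] -/
theorem t12_eq_swap : t12 = swap (0 : Fin 6) 1 := by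
  unfold t12; decide +kernel

/-- **`S₆ = ⟨(1 2), (1 2 3 4 5 6)⟩`** (Mathlib `closure_cycle_adjacent_swap`). [folklore] -/
theorem closure_t12_c123456 : Subgroup.closure ({t12, c123456} : Set (Perm (Fin 6))) = ⊤ := by
  have h := closure_cycle_adjacent_swap (isCycle_finRotate (n := 4)) (support_finRotate (n := 4))
    (0 : Fin 6)
  have h1 : swap (0 : Fin 6) (finRotate 6 0) = t12 := by unfold t12; decide +kernel
  rw [h1, ← c123456_eq_finRotate, Set.pair_comm] at h
  exact h

/-- **`Stab(6) = ⟨(1 2), (1 2 3 4 5)⟩`** (`S6Subgroups.stabilizer_eq_closure`). [cite: BrumerEtAl2019, Example 5.1.9 p. 1174] -/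
theorem closure_t12_c12345 :
    Subgroup.closure ({t12, c12345} : Set (Perm (Fin 6))) =
      MulAction.stabilizer (Perm (Fin 6)) (5 : Fin 6) := by
  rw [stabilizer_eq_closure]
  unfold gensST
  rw [Matrix.range_cons_cons_empty, Set.pair_comm]

/-- Relations of the generating pair `((1 2), (1 2 3 4 5))` of `Stab(6)`. [folklore] -/
theorem rel_t12_c12345 : t12 ^ 2 = 1 ∧ t12 ≠ 1 ∧ c12345 ^ 5 = 1 ∧ c12345 ≠ 1 ∧
    ⁅t12, c12345 ^ 2⁆ ^ 2 = 1 ∧ t12 5 = 5 ∧ c12345 5 = 5 := by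
  unfold t12 c12345
  refine ⟨?_, ?_, ?_, ?_, ?_, ?_, ?_⟩ <;> decide +kernel

/-- Relations of the generating pair `((1 2), (1 2 3 4 5 6))` of `S₆`. [folklore] -/
theorem rel_t12_c123456 : (t12 * c123456) ^ 5 = 1 ∧ c123456 ^ 2 ≠ 1 ∧ ⁅t12, c123456 ^ 2⁆ ^ 2 = 1 := by
  unfold t12 c123456
  refine ⟨?_, ?_, ?_⟩ <;> decide +kernel

set_option synthInstance.maxSize 2048 in
/-- KERNEL CHECK (**rigidity of the generating pair of `S₅(b) = Stab(6)`**): an involution `x ≠ 1` and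
an element `y` of order `5`, both fixing `6`, with `(⁅x, y²⁆)² = 1`, are SIMULTANEOUSLY conjugate in `S₆`
to `((1 2), (1 2 3 4 5))`.  (The relation set cuts out exactly the `Inn`-orbit of the pair; every
automorphism of `S₅` is inner.) [folklore] -/
theorem exists_conj_pair_S5b : ∀ x : Perm (Fin 6), x 5 = 5 → x ^ 2 = 1 → x ≠ 1 →
    ∀ y : Perm (Fin 6), y 5 = 5 → y ^ 5 = 1 → y ≠ 1 → ⁅x, y ^ 2⁆ ^ 2 = 1 →
    ∃ π : Perm (Fin 6), π * t12 * π⁻¹ = x ∧ π * c12345 * π⁻¹ = y := by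
  unfold t12 c12345
  decide +kernel

/-- KERNEL CHECK (**rigidity of the generating pair of `S₆` through a transposition**): if
`((1 2) y)⁵ = 1`, `y² ≠ 1` and `(⁅(1 2), y²⁆)² = 1` then `((1 2), y)` is simultaneously conjugate to
`((1 2), (1 2 3 4 5 6))` — an automorphism of `S₆` fixing the transposition `(1 2)` is inner
([BPPTVY, §5.1 p. 1173]: the outer automorphism "sends transpositions to products of three
transpositions"). [cite: BrumerEtAl2019, §5.1 p. 1173] -/
theorem exists_conj_pair_S6 : ∀ y : Perm (Fin 6), (t12 * y) ^ 5 = 1 → y ^ 2 ≠ 1 →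
    ⁅t12, y ^ 2⁆ ^ 2 = 1 → ∃ π : Perm (Fin 6), π * t12 * π⁻¹ = t12 ∧ π * c123456 * π⁻¹ = y := by
  unfold t12 c123456
  decide +kernel

/-- KERNEL CHECK: every transposition is conjugate to `(1 2)`. [folklore] -/
theorem exists_conj_swap_eq_t12 : ∀ a b : Fin 6, a ≠ b →
    ∃ g : Perm (Fin 6), g * swap a b * g⁻¹ = t12 := by
  unfold t12
  decide +kernel

/-- `(1 2 3)(4 5 6)` (letters `0,…,5`): the normal form of cycle type `3²`. [cite: BrumerEtAl2019, (5.1.8) p. 1173] -/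
def c123c456 : Perm (Fin 6) := c[(0 : Fin 6), 1, 2] * c[(3 : Fin 6), 4, 5]

/-- KERNEL CHECK: an element of order `3` of `S₆` WITH a fixed letter (class `3¹`) is conjugate to
`(1 2 3)`. [folklore] -/
theorem exists_conj_eq_c123 : ∀ v : Perm (Fin 6), v ^ 3 = 1 → v ≠ 1 → (∃ z, v z = z) →
    ∃ g : Perm (Fin 6), g * v * g⁻¹ = c123 := by
  unfold c123
  decide +kernel

/-- KERNEL CHECK: an element of order `3` of `S₆` WITHOUT fixed letter (class `3²`) is conjugate to
`(1 2 3)(4 5 6)`. [folklore] -/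
theorem exists_conj_eq_c123c456 : ∀ v : Perm (Fin 6), v ^ 3 = 1 → v ≠ 1 → (∀ z, v z ≠ z) →
    ∃ g : Perm (Fin 6), g * v * g⁻¹ = c123c456 := by
  unfold c123c456
  decide +kernel

/-- KERNEL CHECK (**(5.1.8), class `3¹`**, normalised): an involution `x ≠ 1` of `S₆` commuting with
the `3`-cycle `(1 2 3)` is a transposition. [cite: BrumerEtAl2019, Lemma 5.1.5 / (5.1.8) p. 1173] -/
theorem isSwap_of_commute_c123 : ∀ x : Perm (Fin 6), x ^ 2 = 1 → x ≠ 1 → ⁅x, c123⁆ = 1 →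
    ∃ a b : Fin 6, a ≠ b ∧ x = swap a b := by
  unfold c123
  decide +kernel

/-- KERNEL CHECK: `(4 5) ≠ 1` commutes with `(1 2 3)`. [folklore] -/
theorem rel_swap34_c123 : swap (3 : Fin 6) 4 ≠ 1 ∧ ⁅swap (3 : Fin 6) 4, c123⁆ = 1 := by
  unfold c123
  refine ⟨?_, ?_⟩ <;> decide +kernel

set_option synthInstance.maxSize 2048 in
/-- KERNEL CHECK (**(5.1.8), class `3²`**, normalised): with `v = (1 2 3)(4 5 6)`, an involution
`x ≠ 1` with `x v` of order `6` and `x v ≠ v x` is a transposition (products of three transpositions —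
the images of transpositions under the outer automorphism — fail these relations). [cite: BrumerEtAl2019, Lemma 5.1.5 / (5.1.8) p. 1173] -/
theorem isSwap_of_rel_c123c456 : ∀ x : Perm (Fin 6), x ^ 2 = 1 → x ≠ 1 → (x * c123c456) ^ 6 = 1 →
    (x * c123c456) ^ 2 ≠ 1 → (x * c123c456) ^ 3 ≠ 1 → ⁅x, c123c456⁆ ≠ 1 →
    ∃ a b : Fin 6, a ≠ b ∧ x = swap a b := by
  unfold c123c456
  decide +kernel

/-- KERNEL CHECK: `(1 2)·(1 2 3)(4 5 6)` has order `6` and `(1 2)` does not commute with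
`(1 2 3)(4 5 6)`. [folklore] -/
theorem rel_t12_c123c456 : (t12 * c123c456) ^ 6 = 1 ∧ (t12 * c123c456) ^ 2 ≠ 1 ∧
    (t12 * c123c456) ^ 3 ≠ 1 ∧ ⁅t12, c123c456⁆ ≠ 1 := by
  unfold t12 c123c456
  refine ⟨?_, ?_, ?_, ?_⟩ <;> decide +kernel

/-- KERNEL CHECK (**(5.1.8) as a fixed-letter criterion**): for `v ∈ S₆` of order `3`,
`v` has a fixed letter (class `3¹`) iff `#Fix(v)` is odd — i.e. iff `tr ι(v) = 1`
(`GSp4F2.trace_iota_eq_card_fixed`); class `3²` has trace `0`. [cite: BrumerEtAl2019, Lemma 5.1.5 / (5.1.8) p. 1173] -/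
theorem exists_fixed_iff_card_fixed_odd : ∀ v : Perm (Fin 6), v ^ 3 = 1 → v ≠ 1 →
    ((∃ z, v z = z) ↔ (((Finset.univ.filter fun x => v x = x).card : ℕ) : ZMod 2) = 1) := by
  decide +kernel

/-- `#Stab(x) ≠ #S₆` (a transposition moving `x` is missing). [folklore] -/
theorem card_stabilizer_ne_card_top (x : Fin 6) :
    Nat.card (MulAction.stabilizer (Perm (Fin 6)) x) ≠ Nat.card (⊤ : Subgroup (Perm (Fin 6))) := by
  intro h
  rw [Subgroup.card_top, Subgroup.card_eq_iff_eq_top] at h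
  obtain ⟨y, hy⟩ := exists_ne x
  have hmem : swap x y ∈ MulAction.stabilizer (Perm (Fin 6)) x := by rw [h]; exact Subgroup.mem_top _
  rw [MulAction.mem_stabilizer_iff, Perm.smul_def, swap_apply_left] at hmem
  exact hy hmem

/-! ### B. Transport along `ker σ₁ = ker σ₂` (permutation level) -/

section Perm

variable {Γ : Type*} [Group Γ]

/-- Two homomorphisms with the same kernel identify the same pairs of words:
`σ₁ α = σ₁ β ↔ σ₂ α = σ₂ β`. [folklore] -/
theorem map_eq_iff_of_ker_iff {H : Type*} [Group H] {σ₁ σ₂ : Γ →* H}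
    (hker : ∀ γ, σ₁ γ = 1 ↔ σ₂ γ = 1) (α β : Γ) : σ₁ α = σ₁ β ↔ σ₂ α = σ₂ β := by
  rw [← mul_inv_eq_one, ← map_inv, ← map_mul, hker, map_mul, map_inv, mul_inv_eq_one]

/-- Homomorphisms with the same kernel have images of the same order (`#Γ/ker`). [folklore] -/
theorem card_range_eq_of_ker_iff {H : Type*} [Group H] (σ₁ σ₂ : Γ →* H)
    (hker : ∀ γ, σ₁ γ = 1 ↔ σ₂ γ = 1) : Nat.card σ₁.range = Nat.card σ₂.range := by
  have hk : σ₁.ker = σ₂.ker := by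
    ext γ
    rw [MonoidHom.mem_ker, MonoidHom.mem_ker]
    exact hker γ
  rw [← Subgroup.index_ker, ← Subgroup.index_ker, hk]

/-- **Transport of conjugacy from generators.** If `ker σ₁ = ker σ₂`, `σ₂ = π σ₁ π⁻¹` on a set `s`, and
`σ₁(s)` generates `σ₁(Γ)`, then `σ₂ = π σ₁ π⁻¹` everywhere. [folklore] -/
theorem conj_of_conj_on_generators {σ₁ σ₂ : Γ →* Perm (Fin 6)}
    (hker : ∀ γ, σ₁ γ = 1 ↔ σ₂ γ = 1) (π : Perm (Fin 6)) (s : Set Γ)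
    (hs : ∀ g ∈ s, σ₂ g = π * σ₁ g * π⁻¹)
    (hgen : ∀ γ, σ₁ γ ∈ Subgroup.closure (σ₁ '' s)) :
    ∀ γ, σ₂ γ = π * σ₁ γ * π⁻¹ := by
  intro γ
  have hγ := hgen γ
  rw [← MonoidHom.map_closure, Subgroup.mem_map] at hγ
  obtain ⟨δ, hδ, hδγ⟩ := hγ
  have h2 : σ₂ γ = σ₂ δ := (map_eq_iff_of_ker_iff hker γ δ).1 hδγ.symm
  have heq : Set.EqOn σ₂ ((MulAut.conj π).toMonoidHom.comp σ₁) (Subgroup.closure s : Set Γ) :=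
    MonoidHom.eqOn_closure fun g hg => hs g hg
  rw [h2, ← hδγ]
  exact heq hδ

/-- `γ ↦ g σ(γ) g⁻¹`. [folklore] -/
def conjHom (g : Perm (Fin 6)) (σ : Γ →* Perm (Fin 6)) : Γ →* Perm (Fin 6) :=
  (MulAut.conj g).toMonoidHom.comp σ

/-- `conjHom g σ γ = g σ(γ) g⁻¹`. [folklore] -/
@[simp] theorem conjHom_apply (g : Perm (Fin 6)) (σ : Γ →* Perm (Fin 6)) (γ : Γ) :
    conjHom g σ γ = g * σ γ * g⁻¹ := rfl

/-- `conjHom g σ` has the kernel of `σ`. [folklore] -/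
theorem conjHom_eq_one_iff (g : Perm (Fin 6)) (σ : Γ →* Perm (Fin 6)) (γ : Γ) :
    conjHom g σ γ = 1 ↔ σ γ = 1 := by
  rw [conjHom_apply]; exact conj_eq_one_iff

/-- `conjHom g σ` is onto if `σ` is. [folklore] -/
theorem conjHom_surjective {σ : Γ →* Perm (Fin 6)} (h : Function.Surjective σ) (g : Perm (Fin 6)) :
    Function.Surjective (conjHom g σ) := fun s => by
  obtain ⟨γ, hγ⟩ := h (g⁻¹ * s * g)
  exact ⟨γ, by rw [conjHom_apply, hγ]; group⟩

/-- Conjugacy of `(g₁ σ₁ g₁⁻¹, g₂ σ₂ g₂⁻¹)` gives conjugacy of `(σ₁, σ₂)`. [folklore] -/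
theorem exists_conj_of_exists_conj_conjHom {σ₁ σ₂ : Γ →* Perm (Fin 6)} (g₁ g₂ : Perm (Fin 6))
    (h : ∃ π : Perm (Fin 6), ∀ γ, conjHom g₂ σ₂ γ = π * conjHom g₁ σ₁ γ * π⁻¹) :
    ∃ ϖ : Perm (Fin 6), ∀ γ, σ₂ γ = ϖ * σ₁ γ * ϖ⁻¹ := by
  obtain ⟨π, hπ⟩ := h
  refine ⟨g₂⁻¹ * π * g₁, fun γ => ?_⟩
  have hγ := hπ γ
  rw [conjHom_apply, conjHom_apply] at hγ
  calc σ₂ γ = g₂⁻¹ * (g₂ * σ₂ γ * g₂⁻¹) * g₂ := by group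
    _ = g₂⁻¹ * (π * (g₁ * σ₁ γ * g₁⁻¹) * π⁻¹) * g₂ := by rw [hγ]
    _ = (g₂⁻¹ * π * g₁) * σ₁ γ * (g₂⁻¹ * π * g₁)⁻¹ := by group

/-- **Rigidity, image `S₅(b)`, normalised form.** `σ₁(Γ) = Stab(6)`, `σ₂(Γ) ≤ Stab(6)`,
`ker σ₁ = ker σ₂` ⇒ `σ₂ = π σ₁ π⁻¹`. [cite: BrumerEtAl2019, Lemma 7.1.4 p. 1187] -/
theorem exists_conj_of_ker_iff_of_range_eq_stabilizer_five {σ₁ σ₂ : Γ →* Perm (Fin 6)}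
    (hker : ∀ γ, σ₁ γ = 1 ↔ σ₂ γ = 1)
    (h₁ : σ₁.range = MulAction.stabilizer (Perm (Fin 6)) (5 : Fin 6)) (h₂ : ∀ γ, σ₂ γ 5 = 5) :
    ∃ π : Perm (Fin 6), ∀ γ, σ₂ γ = π * σ₁ γ * π⁻¹ := by
  have hsurj : ∀ s : Perm (Fin 6), s 5 = 5 → ∃ γ, σ₁ γ = s := fun s hs => by
    have hs' : s ∈ σ₁.range := by rw [h₁, MulAction.mem_stabilizer_iff, Perm.smul_def]; exact hs
    exact hs'
  obtain ⟨R1, R2, R3, R4, R5, R6, R7⟩ := rel_t12_c12345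
  obtain ⟨a, ha⟩ := hsurj t12 R6
  obtain ⟨b, hb⟩ := hsurj c12345 R7
  have T := map_eq_iff_of_ker_iff hker
  have hx2 : σ₂ a ^ 2 = 1 := by
    have h := (T (a ^ 2) 1).1 (by rw [map_pow, map_one, ha]; exact R1)
    rwa [map_pow, map_one] at h
  have hx1 : σ₂ a ≠ 1 := fun h => R2 (by
    have h' := (T a 1).2 (by rw [h, map_one])
    rwa [ha, map_one] at h')
  have hy5 : σ₂ b ^ 5 = 1 := by
    have h := (T (b ^ 5) 1).1 (by rw [map_pow, map_one, hb]; exact R3)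
    rwa [map_pow, map_one] at h
  have hy1 : σ₂ b ≠ 1 := fun h => R4 (by
    have h' := (T b 1).2 (by rw [h, map_one])
    rwa [hb, map_one] at h')
  have hc : ⁅σ₂ a, σ₂ b ^ 2⁆ ^ 2 = 1 := by
    have h := (T (⁅a, b ^ 2⁆ ^ 2) 1).1
      (by rw [map_pow, map_commutatorElement, map_pow, map_one, ha, hb]; exact R5)
    rwa [map_pow, map_commutatorElement, map_pow, map_one] at h
  obtain ⟨π, hπa, hπb⟩ := exists_conj_pair_S5b (σ₂ a) (h₂ a) hx2 hx1 (σ₂ b) (h₂ b) hy5 hy1 hc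
  refine ⟨π, conj_of_conj_on_generators hker π {a, b} ?_ ?_⟩
  · intro g hg
    rcases hg with rfl | rfl
    · rw [ha, hπa]
    · rw [hb, hπb]
  · intro γ
    rw [Set.image_pair, ha, hb, closure_t12_c12345, ← h₁]
    exact ⟨γ, rfl⟩

/-- **Rigidity, image `S₅(b)` ("every automorphism of `S₅` is inner").** If `σ₁(Γ) = Stab(x₁)`,
`σ₂(Γ) ≤ Stab(x₂)` and `ker σ₁ = ker σ₂`, then `σ₂ = π σ₁ π⁻¹` for some `π ∈ S₆` — the residual
equivalence of [BPPTVY, Lemma 7.1.4] (277; likewise 349, 461) once both images are known to be point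
stabilisers with the same fixed field. [cite: BrumerEtAl2019, Lemma 7.1.4 p. 1187] -/
theorem exists_conj_of_ker_iff_of_range_eq_stabilizer {σ₁ σ₂ : Γ →* Perm (Fin 6)}
    (hker : ∀ γ, σ₁ γ = 1 ↔ σ₂ γ = 1) {x₁ x₂ : Fin 6}
    (h₁ : σ₁.range = MulAction.stabilizer (Perm (Fin 6)) x₁) (h₂ : ∀ γ, σ₂ γ x₂ = x₂) :
    ∃ π : Perm (Fin 6), ∀ γ, σ₂ γ = π * σ₁ γ * π⁻¹ := by
  refine exists_conj_of_exists_conj_conjHom (swap 5 x₁) (swap 5 x₂)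
    (exists_conj_of_ker_iff_of_range_eq_stabilizer_five ?_ ?_ ?_)
  · intro γ; rw [conjHom_eq_one_iff, conjHom_eq_one_iff]; exact hker γ
  · rw [conjHom, ← MonoidHom.map_range, h₁, ← MulAction.stabilizer_smul_eq_stabilizer_map_conj,
      Perm.smul_def, swap_apply_right]
  · intro γ
    rw [conjHom_apply, Perm.mul_apply, Perm.mul_apply, swap_inv, swap_apply_left, h₂,
      swap_apply_right]

/-- **Rigidity, image `S₆`, normalised form.** `σ₁` onto `S₆`, `ker σ₁ = ker σ₂`, and
`σ₁(i) = σ₂(i) = (1 2)` for one `i` ⇒ `σ₂ = π σ₁ π⁻¹`. [cite: BrumerEtAl2019, §5.1 p. 1173, Thm 7.3.1 p. 1191] -/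
theorem exists_conj_of_ker_iff_of_eq_t12 {σ₁ σ₂ : Γ →* Perm (Fin 6)}
    (hker : ∀ γ, σ₁ γ = 1 ↔ σ₂ γ = 1) (h₁ : Function.Surjective σ₁) {i : Γ}
    (hi₁ : σ₁ i = t12) (hi₂ : σ₂ i = t12) :
    ∃ π : Perm (Fin 6), ∀ γ, σ₂ γ = π * σ₁ γ * π⁻¹ := by
  obtain ⟨b, hb⟩ := h₁ c123456
  obtain ⟨R1, R2, R3⟩ := rel_t12_c123456
  have T := map_eq_iff_of_ker_iff hker
  have hxy5 : (t12 * σ₂ b) ^ 5 = 1 := by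
    have h := (T ((i * b) ^ 5) 1).1 (by rw [map_pow, map_mul, map_one, hi₁, hb]; exact R1)
    rwa [map_pow, map_mul, map_one, hi₂] at h
  have hy2 : σ₂ b ^ 2 ≠ 1 := fun h => R2 (by
    have h' := (T (b ^ 2) 1).2 (by rw [map_pow, map_one, h])
    rwa [map_pow, map_one, hb] at h')
  have hc : ⁅t12, σ₂ b ^ 2⁆ ^ 2 = 1 := by
    have h := (T (⁅i, b ^ 2⁆ ^ 2) 1).1
      (by rw [map_pow, map_commutatorElement, map_pow, map_one, hi₁, hb]; exact R3)
    rwa [map_pow, map_commutatorElement, map_pow, map_one, hi₂] at h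
  obtain ⟨π, hπa, hπb⟩ := exists_conj_pair_S6 (σ₂ b) hxy5 hy2 hc
  refine ⟨π, conj_of_conj_on_generators hker π {i, b} ?_ ?_⟩
  · intro g hg
    rcases hg with rfl | rfl
    · rw [hi₁, hπa, hi₂]
    · rw [hb, hπb]
  · intro γ
    rw [Set.image_pair, hi₁, hb, closure_t12_c123456]
    exact Subgroup.mem_top _

/-- **Rigidity, image `S₆`, through one common transposition** ("an automorphism of `S₆` preserving a
transposition is inner"; the outer one sends transpositions to triple transpositions,
[BPPTVY, §5.1 p. 1173]).  `σ₁` onto `S₆`, `ker σ₁ = ker σ₂`, and `σ₁(i)`, `σ₂(i)` both transpositions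
(`=` transvections under `ι`, `isTransvection_iota_iff`; e.g. `i` an inertia generator at `p ∥ N`)
⇒ `σ₂ = π σ₁ π⁻¹`. [cite: BrumerEtAl2019, §5.1 p. 1173, Example 5.1.9 p. 1174] -/
theorem exists_conj_of_ker_iff_of_isSwap {σ₁ σ₂ : Γ →* Perm (Fin 6)}
    (hker : ∀ γ, σ₁ γ = 1 ↔ σ₂ γ = 1) (h₁ : Function.Surjective σ₁) {i : Γ}
    (hi₁ : (σ₁ i).IsSwap) (hi₂ : (σ₂ i).IsSwap) :
    ∃ π : Perm (Fin 6), ∀ γ, σ₂ γ = π * σ₁ γ * π⁻¹ := by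
  obtain ⟨p₁, q₁, hpq₁, h₁eq⟩ := hi₁
  obtain ⟨p₂, q₂, hpq₂, h₂eq⟩ := hi₂
  obtain ⟨g₁, hg₁⟩ := exists_conj_swap_eq_t12 p₁ q₁ hpq₁
  obtain ⟨g₂, hg₂⟩ := exists_conj_swap_eq_t12 p₂ q₂ hpq₂
  refine exists_conj_of_exists_conj_conjHom g₁ g₂
    (exists_conj_of_ker_iff_of_eq_t12 (i := i) ?_ (conjHom_surjective h₁ g₁) ?_ ?_)
  · intro γ; rw [conjHom_eq_one_iff, conjHom_eq_one_iff]; exact hker γ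
  · rw [conjHom_apply, h₁eq, hg₁]
  · rw [conjHom_apply, h₂eq, hg₂]

/-- **Rigidity, image `S₆`, printed `587` form** ([BPPTVY, Thm 7.3.1, proof p. 1192]: "the residual
representation of `f` corresponds to the same extension as `A`, and since both representations have the
same trace at `Frob₃`, we deduce that they are indeed equivalent").  `σ₁` onto `S₆`, `ker σ₁ = ker σ₂`,
`σ₁(u)` of order `3`, and `σ₁(u)`, `σ₂(u)` in the same class `3¹`/`3²` (= same trace under `ι`,
`exists_fixed_iff_card_fixed_odd` + `trace_iota_eq_card_fixed`) ⇒ `σ₂ = π σ₁ π⁻¹`. [cite: BrumerEtAl2019, (5.1.8) p. 1173, Thm 7.3.1 pp. 1191–1192] -/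
theorem exists_conj_of_ker_iff_of_orderThree {σ₁ σ₂ : Γ →* Perm (Fin 6)}
    (hker : ∀ γ, σ₁ γ = 1 ↔ σ₂ γ = 1) (h₁ : Function.Surjective σ₁) {u : Γ}
    (hu3 : σ₁ u ^ 3 = 1) (hu1 : σ₁ u ≠ 1) (hfix : (∃ z, σ₁ u z = z) ↔ (∃ z, σ₂ u z = z)) :
    ∃ π : Perm (Fin 6), ∀ γ, σ₂ γ = π * σ₁ γ * π⁻¹ := by
  have T := map_eq_iff_of_ker_iff hker
  have hv3 : σ₂ u ^ 3 = 1 := by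
    have h := (T (u ^ 3) 1).1 (by rw [map_pow, map_one]; exact hu3)
    rwa [map_pow, map_one] at h
  have hv1 : σ₂ u ≠ 1 := fun h => hu1 (by
    have h' := (T u 1).2 (by rw [h, map_one])
    rwa [map_one] at h')
  -- kernels and surjectivity are stable under the normalising conjugations below
  have hkerN : ∀ g₁ g₂ : Perm (Fin 6), ∀ γ, conjHom g₁ σ₁ γ = 1 ↔ conjHom g₂ σ₂ γ = 1 :=
    fun g₁ g₂ γ => (conjHom_eq_one_iff g₁ σ₁ γ).trans ((hker γ).trans (conjHom_eq_one_iff g₂ σ₂ γ).symm)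
  by_cases hz : ∃ z, σ₁ u z = z
  · -- class 3¹: normalise both images of `u` to (1 2 3); a preimage of (4 5) under g₁σ₁g₁⁻¹ maps,
    -- under g₂σ₂g₂⁻¹, to an involution commuting with (1 2 3), hence to a transposition
    obtain ⟨g₁, hg₁⟩ := exists_conj_eq_c123 (σ₁ u) hu3 hu1 hz
    obtain ⟨g₂, hg₂⟩ := exists_conj_eq_c123 (σ₂ u) hv3 hv1 (hfix.1 hz)
    refine exists_conj_of_exists_conj_conjHom g₁ g₂ ?_
    have hK := hkerN g₁ g₂
    have T' := map_eq_iff_of_ker_iff hK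
    have hS := conjHom_surjective h₁ g₁
    have hu₁ : conjHom g₁ σ₁ u = c123 := (conjHom_apply g₁ σ₁ u).trans hg₁
    have hu₂ : conjHom g₂ σ₂ u = c123 := (conjHom_apply g₂ σ₂ u).trans hg₂
    obtain ⟨R1, R2⟩ := rel_swap34_c123
    obtain ⟨i, hi⟩ := hS (swap (3 : Fin 6) 4)
    have hx2 : conjHom g₂ σ₂ i ^ 2 = 1 := by
      have h := (T' (i ^ 2) 1).1 (by rw [map_pow, map_one, hi, pow_two, swap_mul_self])
      rwa [map_pow, map_one] at h
    have hx1 : conjHom g₂ σ₂ i ≠ 1 := fun h => R1 (by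
      have h' := (T' i 1).2 (by rw [h, map_one])
      rwa [hi, map_one] at h')
    have hc : ⁅conjHom g₂ σ₂ i, c123⁆ = 1 := by
      have h := (T' ⁅i, u⁆ 1).1 (by rw [map_commutatorElement, map_one, hi, hu₁]; exact R2)
      rwa [map_commutatorElement, map_one, hu₂] at h
    have hsw := isSwap_of_commute_c123 (conjHom g₂ σ₂ i) hx2 hx1 hc
    exact exists_conj_of_ker_iff_of_isSwap hK hS ⟨3, 4, by decide, hi⟩ hsw
  · -- class 3²: normalise both images of `u` to (1 2 3)(4 5 6); a preimage of (1 2) under g₁σ₁g₁⁻¹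
    -- maps, under g₂σ₂g₂⁻¹, to an involution satisfying the relations of `isSwap_of_rel_c123c456`
    have hz₁ : ∀ z, σ₁ u z ≠ z := fun z h => hz ⟨z, h⟩
    have hz₂ : ∀ z, σ₂ u z ≠ z := fun z h => hz (hfix.2 ⟨z, h⟩)
    obtain ⟨g₁, hg₁⟩ := exists_conj_eq_c123c456 (σ₁ u) hu3 hu1 hz₁
    obtain ⟨g₂, hg₂⟩ := exists_conj_eq_c123c456 (σ₂ u) hv3 hv1 hz₂
    refine exists_conj_of_exists_conj_conjHom g₁ g₂ ?_
    have hK := hkerN g₁ g₂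
    have T' := map_eq_iff_of_ker_iff hK
    have hS := conjHom_surjective h₁ g₁
    have hu₁ : conjHom g₁ σ₁ u = c123c456 := (conjHom_apply g₁ σ₁ u).trans hg₁
    have hu₂ : conjHom g₂ σ₂ u = c123c456 := (conjHom_apply g₂ σ₂ u).trans hg₂
    obtain ⟨E1, E2, E3, E4⟩ := rel_t12_c123c456
    obtain ⟨R1, R2, -⟩ := rel_t12_c12345
    obtain ⟨i, hi⟩ := hS t12
    have hx2 : conjHom g₂ σ₂ i ^ 2 = 1 := by
      have h := (T' (i ^ 2) 1).1 (by rw [map_pow, map_one, hi]; exact R1)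
      rwa [map_pow, map_one] at h
    have hx1 : conjHom g₂ σ₂ i ≠ 1 := fun h => R2 (by
      have h' := (T' i 1).2 (by rw [h, map_one])
      rwa [hi, map_one] at h')
    have h6 : (conjHom g₂ σ₂ i * c123c456) ^ 6 = 1 := by
      have h := (T' ((i * u) ^ 6) 1).1 (by rw [map_pow, map_mul, map_one, hi, hu₁]; exact E1)
      rwa [map_pow, map_mul, map_one, hu₂] at h
    have h2 : (conjHom g₂ σ₂ i * c123c456) ^ 2 ≠ 1 := fun h => E2 (by
      have h' := (T' ((i * u) ^ 2) 1).2 (by rw [map_pow, map_mul, map_one, hu₂]; exact h)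
      rwa [map_pow, map_mul, map_one, hi, hu₁] at h')
    have h3 : (conjHom g₂ σ₂ i * c123c456) ^ 3 ≠ 1 := fun h => E3 (by
      have h' := (T' ((i * u) ^ 3) 1).2 (by rw [map_pow, map_mul, map_one, hu₂]; exact h)
      rwa [map_pow, map_mul, map_one, hi, hu₁] at h')
    have hc : ⁅conjHom g₂ σ₂ i, c123c456⁆ ≠ 1 := fun h => E4 (by
      have h' := (T' ⁅i, u⁆ 1).2 (by rw [map_commutatorElement, map_one, hu₂]; exact h)
      rwa [map_commutatorElement, map_one, hi, hu₁] at h')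
    have hsw := isSwap_of_rel_c123c456 (conjHom g₂ σ₂ i) hx2 hx1 h6 h2 h3 hc
    exact exists_conj_of_ker_iff_of_isSwap hK hS ⟨0, 1, by decide, hi.trans t12_eq_swap⟩ hsw

end Perm

/-! ### C. Matrix level: `σ₁ σ₂ : Γ →* Sp₄(𝔽₂) = ι(S₆)` -/

section MatrixLevel

variable {Γ : Type*} [Group Γ]

/-- The underlying matrix of `iotaMulEquiv π` is `ι(π)`. [cite: BrumerEtAl2019, (5.1.1) p. 1173] -/
theorem coe_iotaMulEquiv (π : Perm (Fin 6)) :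
    ((iotaMulEquiv π : iotaGL.range) : GL (Fin 4) (ZMod 2)) = iotaGL π :=
  MonoidHom.ofInjective_apply iotaGL_injective

/-- **Permutation model of a symplectic mod-`2` representation**: `σ : Γ → Sp₄(𝔽₂) = ι(S₆)` pulled
back through `ι : S₆ ⥲ Sp₄(𝔽₂)` (`iotaMulEquiv`). [cite: BrumerEtAl2019, (5.1.1) p. 1173] -/
noncomputable def permLift (σ : Γ →* GL (Fin 4) (ZMod 2)) (hSp : σ.range ≤ iotaGL.range) :
    Γ →* Perm (Fin 6) :=
  iotaMulEquiv.symm.toMonoidHom.comp (σ.codRestrict iotaGL.range fun γ => hSp ⟨γ, rfl⟩)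

/-- `ι (permLift σ γ) = σ γ`. [cite: BrumerEtAl2019, (5.1.1) p. 1173] -/
theorem iotaGL_permLift (σ : Γ →* GL (Fin 4) (ZMod 2)) (hSp : σ.range ≤ iotaGL.range) (γ : Γ) :
    iotaGL (permLift σ hSp γ) = σ γ := by
  show iotaGL (iotaMulEquiv.symm ⟨σ γ, hSp ⟨γ, rfl⟩⟩) = σ γ
  rw [← coe_iotaMulEquiv, MulEquiv.apply_symm_apply]

/-- `ι (permLift σ γ) = σ γ` as matrices. [cite: BrumerEtAl2019, (5.1.1) p. 1173] -/
theorem iota_permLift (σ : Γ →* GL (Fin 4) (ZMod 2)) (hSp : σ.range ≤ iotaGL.range) (γ : Γ) :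
    iota (permLift σ hSp γ) = (σ γ : Matrix (Fin 4) (Fin 4) (ZMod 2)) := by
  rw [← coe_iotaGL, iotaGL_permLift]

/-- `permLift σ` has the kernel of `σ`. [cite: BrumerEtAl2019, (5.1.1) p. 1173] -/
theorem permLift_eq_one_iff (σ : Γ →* GL (Fin 4) (ZMod 2)) (hSp : σ.range ≤ iotaGL.range) (γ : Γ) :
    permLift σ hSp γ = 1 ↔ σ γ = 1 := by
  constructor
  · intro h; rw [← iotaGL_permLift σ hSp γ, h, map_one]
  · intro h; apply iotaGL_injective; rw [iotaGL_permLift, h, map_one]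

/-- `ι (permLift σ (Γ)) = σ(Γ)`. [cite: BrumerEtAl2019, (5.1.1) p. 1173] -/
theorem map_range_permLift (σ : Γ →* GL (Fin 4) (ZMod 2)) (hSp : σ.range ≤ iotaGL.range) :
    (permLift σ hSp).range.map iotaGL = σ.range := by
  ext g
  simp only [Subgroup.mem_map, MonoidHom.mem_range]
  constructor
  · rintro ⟨π, ⟨γ, rfl⟩, rfl⟩
    exact ⟨γ, (iotaGL_permLift σ hSp γ).symm⟩
  · rintro ⟨γ, rfl⟩
    exact ⟨permLift σ hSp γ, ⟨γ, rfl⟩, iotaGL_permLift σ hSp γ⟩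

/-- `σ(Γ) = ι(H)` ⇒ `permLift σ (Γ) = H`. [cite: BrumerEtAl2019, (5.1.1) p. 1173] -/
theorem range_permLift_eq (σ : Γ →* GL (Fin 4) (ZMod 2)) (hSp : σ.range ≤ iotaGL.range)
    {H : Subgroup (Perm (Fin 6))} (h : σ.range = H.map iotaGL) : (permLift σ hSp).range = H :=
  Subgroup.map_injective iotaGL_injective ((map_range_permLift σ hSp).trans h)

/-- Conjugacy of the permutation models gives conjugacy by an element of `Sp₄(𝔽₂) = ι(S₆)`. [cite: BrumerEtAl2019, (5.1.1) p. 1173] -/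
theorem conj_of_permLift_conj (σ₁ σ₂ : Γ →* GL (Fin 4) (ZMod 2)) (hSp₁ : σ₁.range ≤ iotaGL.range)
    (hSp₂ : σ₂.range ≤ iotaGL.range) {π : Perm (Fin 6)}
    (h : ∀ γ, permLift σ₂ hSp₂ γ = π * permLift σ₁ hSp₁ γ * π⁻¹) (γ : Γ) :
    σ₂ γ = iotaGL π * σ₁ γ * (iotaGL π)⁻¹ := by
  rw [← iotaGL_permLift σ₂ hSp₂ γ, ← iotaGL_permLift σ₁ hSp₁ γ, ← map_mul, ← map_inv, ← map_mul]
  exact congrArg iotaGL (h γ)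

/-- **Residual rigidity, image `S₅(b)` (matrix form).**  `σ₁, σ₂ : Γ → GL₄(𝔽₂)` with images
`ι(Stab(x₁))`, `ι(Stab(x₂))` (the `S₅(b)` alternative of `range_eq_S6_or_S5b`) and the same kernel are
conjugate by an element of `Sp₄(𝔽₂)`: the residual equivalence of [BPPTVY, Lemma 7.1.4] from "same
`2`-torsion field, both images `S₅(b)`". [cite: BrumerEtAl2019, Lemma 7.1.4 p. 1187, Example 5.1.9 p. 1174] -/
theorem exists_conj_of_ker_iff_of_range_S5b (σ₁ σ₂ : Γ →* GL (Fin 4) (ZMod 2)) {x₁ x₂ : Fin 6}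
    (h₁ : σ₁.range = (MulAction.stabilizer (Perm (Fin 6)) x₁).map iotaGL)
    (h₂ : σ₂.range = (MulAction.stabilizer (Perm (Fin 6)) x₂).map iotaGL)
    (hker : ∀ γ, σ₁ γ = 1 ↔ σ₂ γ = 1) :
    ∃ π : Perm (Fin 6), ∀ γ, σ₂ γ = iotaGL π * σ₁ γ * (iotaGL π)⁻¹ := by
  have hSp₁ : σ₁.range ≤ iotaGL.range := h₁ ▸ Subgroup.map_le_range _ _
  have hSp₂ : σ₂.range ≤ iotaGL.range := h₂ ▸ Subgroup.map_le_range _ _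
  have hker' : ∀ γ, permLift σ₁ hSp₁ γ = 1 ↔ permLift σ₂ hSp₂ γ = 1 := fun γ => by
    rw [permLift_eq_one_iff, permLift_eq_one_iff]; exact hker γ
  have hr₁ := range_permLift_eq σ₁ hSp₁ h₁
  have hr₂ := range_permLift_eq σ₂ hSp₂ h₂
  have hfix₂ : ∀ γ, permLift σ₂ hSp₂ γ x₂ = x₂ := fun γ => by
    have hmem : permLift σ₂ hSp₂ γ ∈ (permLift σ₂ hSp₂).range := ⟨γ, rfl⟩
    rw [hr₂, MulAction.mem_stabilizer_iff, Perm.smul_def] at hmem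
    exact hmem
  obtain ⟨π, hπ⟩ := exists_conj_of_ker_iff_of_range_eq_stabilizer hker' hr₁ hfix₂
  exact ⟨π, conj_of_permLift_conj σ₁ σ₂ hSp₁ hSp₂ hπ⟩

/-- **Residual rigidity, Route-T form** (the form the pipeline instantiates, `DIVERGENCE.md` D-20).
`σ₁, σ₂ : Γ → Sp₄(𝔽₂)` (symplectic images, `mem_range_iotaGL`) with the same kernel (same `2`-torsion
field), some `σ₁(c)` of order `5` (a Frobenius with characteristic polynomial `Φ₅ mod 2`,
`pow_five_eq_one_of_charpoly`, [BPPTVY, Lemma 5.1.5 / (6.2.4)]) and ONE `i ∈ Γ` at which BOTH `σ₁(i)`,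
`σ₂(i)` are transvections (inertia at `p ∥ N`, [BPPTVY, proof of Prop. 5.2.4 p. 1175]) are conjugate by
an element of `Sp₄(𝔽₂)` — whether the common image class is `S₅(b)` (277, 349, 461;
[BPPTVY, Lemma 7.1.4]) or `S₆` (587; [BPPTVY, Thm 7.3.1]). [cite: BrumerEtAl2019, Lemma 7.1.4 p. 1187, Thm 7.3.1 pp. 1191–1192, Example 5.1.9 p. 1174] -/
theorem exists_conj_of_ker_iff_of_transvection (σ₁ σ₂ : Γ →* GL (Fin 4) (ZMod 2))
    (hSp₁ : σ₁.range ≤ iotaGL.range) (hSp₂ : σ₂.range ≤ iotaGL.range)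
    (hker : ∀ γ, σ₁ γ = 1 ↔ σ₂ γ = 1) {c : Γ} (hc5 : σ₁ c ^ 5 = 1) (hc1 : σ₁ c ≠ 1) {i : Γ}
    (hi₁ : IsTransvection (σ₁ i : Matrix (Fin 4) (Fin 4) (ZMod 2)))
    (hi₂ : IsTransvection (σ₂ i : Matrix (Fin 4) (Fin 4) (ZMod 2))) :
    ∃ π : Perm (Fin 6), ∀ γ, σ₂ γ = iotaGL π * σ₁ γ * (iotaGL π)⁻¹ := by
  set τ₁ := permLift σ₁ hSp₁ with hτ₁
  set τ₂ := permLift σ₂ hSp₂ with hτ₂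
  have hker' : ∀ γ, τ₁ γ = 1 ↔ τ₂ γ = 1 := fun γ => by
    rw [hτ₁, hτ₂, permLift_eq_one_iff, permLift_eq_one_iff]; exact hker γ
  have T := map_eq_iff_of_ker_iff hker'
  have hsw₁ : (τ₁ i).IsSwap := by rw [← isTransvection_iota_iff, hτ₁, iota_permLift]; exact hi₁
  have hsw₂ : (τ₂ i).IsSwap := by rw [← isTransvection_iota_iff, hτ₂, iota_permLift]; exact hi₂
  have hc5₁ : τ₁ c ^ 5 = 1 := by rw [← map_pow, hτ₁, permLift_eq_one_iff, map_pow]; exact hc5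
  have hc1₁ : τ₁ c ≠ 1 := fun h => hc1 ((permLift_eq_one_iff σ₁ hSp₁ c).1 h)
  have hc5₂ : τ₂ c ^ 5 = 1 := by
    have h := (T (c ^ 5) 1).1 (by rw [map_pow, map_one]; exact hc5₁)
    rwa [map_pow, map_one] at h
  have hc1₂ : τ₂ c ≠ 1 := fun h => hc1₁ (by
    have h' := (T c 1).2 (by rw [h, map_one])
    rwa [map_one] at h')
  suffices h : ∃ π : Perm (Fin 6), ∀ γ, τ₂ γ = π * τ₁ γ * π⁻¹ by
    obtain ⟨π, hπ⟩ := h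
    exact ⟨π, conj_of_permLift_conj σ₁ σ₂ hSp₁ hSp₂ hπ⟩
  obtain ⟨a₁, b₁, hab₁, h₁eq⟩ := hsw₁
  obtain ⟨a₂, b₂, hab₂, h₂eq⟩ := hsw₂
  have hτi₁ : swap a₁ b₁ ∈ τ₁.range := by rw [← h₁eq]; exact ⟨i, rfl⟩
  have hτi₂ : swap a₂ b₂ ∈ τ₂.range := by rw [← h₂eq]; exact ⟨i, rfl⟩
  have G1 := eq_stabilizer_or_top_of_swap_mem_of_orderFive_mem τ₁.range hab₁ hτi₁ hc5₁ hc1₁ ⟨c, rfl⟩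
  have G2 := eq_stabilizer_or_top_of_swap_mem_of_orderFive_mem τ₂.range hab₂ hτi₂ hc5₂ hc1₂ ⟨c, rfl⟩
  have hcard := card_range_eq_of_ker_iff τ₁ τ₂ hker'
  rcases G1 with ⟨x₁, hx₁⟩ | htop₁ <;> rcases G2 with ⟨x₂, hx₂⟩ | htop₂
  · refine exists_conj_of_ker_iff_of_range_eq_stabilizer (x₂ := x₂) hker' hx₁ fun γ => ?_
    have hmem : τ₂ γ ∈ τ₂.range := ⟨γ, rfl⟩
    rw [hx₂, MulAction.mem_stabilizer_iff, Perm.smul_def] at hmem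
    exact hmem
  · rw [hx₁, htop₂] at hcard
    exact absurd hcard (card_stabilizer_ne_card_top x₁)
  · rw [htop₁, hx₂] at hcard
    exact absurd hcard.symm (card_stabilizer_ne_card_top x₂)
  · exact exists_conj_of_ker_iff_of_isSwap hker' (MonoidHom.range_eq_top.1 htop₁)
      ⟨a₁, b₁, hab₁, h₁eq⟩ ⟨a₂, b₂, hab₂, h₂eq⟩

/-- **Residual rigidity, printed `587` form (matrix level).**  `σ₁` onto `Sp₄(𝔽₂)`, `σ₂` symplectic
with the same kernel, and `tr σ₁(u) = tr σ₂(u)` at one `u` with `σ₁(u)` of order `3` ⇒ conjugate by an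
element of `Sp₄(𝔽₂)` ("since both representations have the same trace at `Frob₃`, we deduce that they
are indeed equivalent"). [cite: BrumerEtAl2019, Thm 7.3.1 pp. 1191–1192, (5.1.8) p. 1173] -/
theorem exists_conj_of_ker_iff_of_trace_orderThree (σ₁ σ₂ : Γ →* GL (Fin 4) (ZMod 2))
    (h₁ : σ₁.range = iotaGL.range) (hSp₂ : σ₂.range ≤ iotaGL.range)
    (hker : ∀ γ, σ₁ γ = 1 ↔ σ₂ γ = 1) {u : Γ} (hu3 : σ₁ u ^ 3 = 1) (hu1 : σ₁ u ≠ 1)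
    (htr : Matrix.trace (σ₁ u : Matrix (Fin 4) (Fin 4) (ZMod 2)) =
      Matrix.trace (σ₂ u : Matrix (Fin 4) (Fin 4) (ZMod 2))) :
    ∃ π : Perm (Fin 6), ∀ γ, σ₂ γ = iotaGL π * σ₁ γ * (iotaGL π)⁻¹ := by
  have hSp₁ : σ₁.range ≤ iotaGL.range := h₁.le
  set τ₁ := permLift σ₁ hSp₁ with hτ₁
  set τ₂ := permLift σ₂ hSp₂ with hτ₂
  have hker' : ∀ γ, τ₁ γ = 1 ↔ τ₂ γ = 1 := fun γ => by
    rw [hτ₁, hτ₂, permLift_eq_one_iff, permLift_eq_one_iff]; exact hker γ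
  have T := map_eq_iff_of_ker_iff hker'
  have hsurj : Function.Surjective τ₁ := by
    rw [← MonoidHom.range_eq_top]
    exact range_permLift_eq σ₁ hSp₁ (by rw [h₁, MonoidHom.range_eq_map])
  have hu3₁ : τ₁ u ^ 3 = 1 := by rw [← map_pow, hτ₁, permLift_eq_one_iff, map_pow]; exact hu3
  have hu1₁ : τ₁ u ≠ 1 := fun h => hu1 ((permLift_eq_one_iff σ₁ hSp₁ u).1 h)
  have hu3₂ : τ₂ u ^ 3 = 1 := by
    have h := (T (u ^ 3) 1).1 (by rw [map_pow, map_one]; exact hu3₁)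
    rwa [map_pow, map_one] at h
  have hu1₂ : τ₂ u ≠ 1 := fun h => hu1₁ (by
    have h' := (T u 1).2 (by rw [h, map_one])
    rwa [map_one] at h')
  have htr' : (((Finset.univ.filter fun x => τ₁ u x = x).card : ℕ) : ZMod 2) =
      (((Finset.univ.filter fun x => τ₂ u x = x).card : ℕ) : ZMod 2) := by
    rw [← trace_iota_eq_card_fixed, ← trace_iota_eq_card_fixed, hτ₁, hτ₂, iota_permLift,
      iota_permLift]
    exact htr
  have hfix : (∃ z, τ₁ u z = z) ↔ (∃ z, τ₂ u z = z) := by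
    rw [exists_fixed_iff_card_fixed_odd (τ₁ u) hu3₁ hu1₁,
      exists_fixed_iff_card_fixed_odd (τ₂ u) hu3₂ hu1₂, htr']
  obtain ⟨π, hπ⟩ := exists_conj_of_ker_iff_of_orderThree hker' hsurj hu3₁ hu1₁ hfix
  exact ⟨π, conj_of_permLift_conj σ₁ σ₂ hSp₁ hSp₂ hπ⟩

end MatrixLevel

end Literature.NumberTheory.FaltingsSerre.GSp4F2
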